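import Literature.MathematicalPhysics.QuantumFieldTheory.Balaban1983to89.B9Eq3152StoreyHOfFlatWindowLetter

/-!
# `Balaban1983to89.B9Eq343FlatWindowLetterOfLocalHolder` — T. Bałaban, *Propagators for lattice gauge theories in a background field*, Commun. Math. Phys. **99** (1985) 389–434
# [Balaban1985BackgroundPropagators] Thm 3.1 (3.43) p. 398 with [Balaban1984PropagatorsII] (1.9): **THE WINDOWED FLAT LETTER `HflatW` REDUCED TO A LOCAL, WEIGHT-FREE, η-SCALE
# HÖLDER ESTIMATE `Hloc`** — interior regularity of the FLAT massive lattice equation `(Δ^η + 1)u = D^{η*}f` (`Δ^η = (L^{n+1})²Δ_lattice`, mass `L^{−(n+1)}` in lattice units) on a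
# ball of radius `4L^{n+1}` in terms of `sup|u|` and `sup|f|` there — by the WEIGHTED SUP ROW of the flat resolvent already in the tree
# (`B9Eq342CovariantResolventAdjointRowLetters.norm_apply_le_weighted_of_flat_resolvent_covDiv`, constant `≤ 16d` by `B9Eq342CovariantResolventAdjointRowTower.sad_le_sixteen_mul`)
# and the bounded distortion `e^{4d}` of the windowed `cosh` weight over such a ball (`B9Eq343CovariantResolventHolderLetters.weight_le_exp_mul_of_tdist_le`); hence the
# (117) socket for the FULL `𝔊̃_k` ON THE MODEL ⇐ `Hloc` ∧ (HLb).  NE9 crux-team LEAF PROVER 01, gen 93.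

statement-level skeleton of published theorems with citation tags; proofs where landed; nothing here is a claim about the Yang–Mills mass gap

CITATION HEADER (lean-in-tree rule).  Audit cell `pub-balaban`, sub-cell `t4`, BINDER row NE9; filed by NE9 crux-team LEAF PROVER 01 (`b2b-balaban-t4-ne9-formalise-leaf-01`,
gen 93; bears_on: R4/N22).  Source READ first-hand (`paper:balaban1985-cmp99-background-propagators`, pp. 397–398).  COMPOSED BY NAME from the imports.  Nothing printed is a
hypothesis except through `Hloc` and (HLb) (DISPLAYED).

WHAT IS PROVED (sorry-free; proof lane — 0 `def`).
* **`flatWindowLetter_of_localHolder`** — `HflatW` (verbatim the hypothesis of `B9Eq343ResolventHolderRowTowerOfFlatWindow.exists_holderRow_resolvent_covDiv_of_flatWindow`,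
  with `SH := C_loc·(16d+1)·e^{4d}`) ⇐ `Hloc`: for every height, period, windowed rate and centre, the weighted sup row bounds `u` on the ball `d(x,·) ≤ 4L^{n+1}` by
  `16d·F·e^{4d}·W_{x₀}(x)` and the data by `F·e^{4d}·W_{x₀}(x)`; `Hloc` gives the two-point bound.
* **`exists_norm_toCLM115_frakGkPi_le_of_localHolder_hessian`** — the (117) socket `‖toCLM115 ∇_U 𝔊̃_k‖ ≤ max(w̄₀B, w̄₁B)·w̲⁻¹` for the FULL `𝔊̃_k` on the model ⇐ `Hloc` ∧ (HLb)
  (`B9Eq3152StoreyHOfFlatWindowLetter.exists_norm_toCLM115_frakGkPi_le_of_flatWindow_hessian` with `HflatW := flatWindowLetter_of_localHolder Hloc`).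
HONEST SCOPE.  `Hloc` = the LOCAL η-scale `C^β` estimate for the flat massive lattice equation with divergence-form bounded data (ball of radius `4L^{n+1}` → pairs at distance
`≤ L^{n+1}`; expected for `β < 1`; a discrete De Giorgi ∕ Calderón–Zygmund statement, NOT in the tree) is DISPLAYED, not supplied; (HLb) = Thm 3.1 (3.44) untouched.  NOT summit
progress (cell pub-balaban: NE9 NOT PRINTED ∕ NOT PROVED; «NE9 ⇐ the named binders»; row WALLED ON A MODEL (O-NE9-1; #5 UNRULED); spine PROVED 0∕9; rung (B)+1 finite T⁴ — NOT
infinite volume, NOT mass gap, NOT BetaPertH, NOT Clay).  HONEST DEPENDENCY (cell line): continuum YM on T⁴ ⇐ BetaPertH ∧ nine spine estimates (0/9 proved); BetaPertH ⇐ (D1) ∧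
(D4) ∧ CAP+tail; G-an2-4 gates asym, D1 and NE2/3/4.  NEW file; nothing modified.  Net new unproved facts: 0.
-/

noncomputable section

set_option autoImplicit false

open scoped InnerProductSpace ComplexConjugate BigOperators

namespace Literature.MathematicalPhysics.QuantumFieldTheory.Balaban1983to89.B9Eq343FlatWindowLetterOfLocalHolder

/-! ## §1 The windowed flat letter from the local Hölder estimate -/

section Reduction

open B4Sect5Torus (TSite tdist tdist_nonneg tdist_symm)
open B4TorusKernel.MultiPeriod (circAbs)
open B9SectCLatticeCarrier (Bond bpos)
open B9Eq311L2Pairing (WL2)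
open B11Eq103H1Complex (SiteL2K BondL2K covDivL2K covLaplaceSiteK)
open B9Eq315QTower (towerP towerP_apply)
open B9Eq342CovariantResolventAdjointRowLetters (norm_apply_le_weighted_of_flat_resolvent_covDiv)
open B9Eq342CovariantResolventAdjointRowTower (sad_le_sixteen_mul)
open B9Eq343CovariantResolventHolderLetters (weight_le_exp_mul_of_tdist_le)

variable {d : ℕ} (L : ℕ) [NeZero L] {W : Type*} [NormedAddCommGroup W] [InnerProductSpace ℂ W]

/-- **`HflatW` ⇐ `Hloc`: the windowed, `cosh`-weighted flat two-point letter from the LOCAL weight-free η-scale Hölder estimate**, with `SH := C_loc·(16d+1)·e^{4d}` — the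
weighted sup row of the flat resolvent (`≤ 16d·F·W_{x₀}` inside the window) and the weight's distortion `≤ e^{4d}` over the ball `d(x,·) ≤ 4L^{n+1}` (`aL^{n+1} ≤ 1`) turn the
local letters `sup|u| ≤ M_u`, `sup|f| ≤ M_f` into multiples of `F·W_{x₀}(x)`. [folklore]
[cite: Balaban1985BackgroundPropagators, Thm 3.1 (3.43) p.398, (3.40) p.397] [cite: Balaban1984PropagatorsII, (1.9) p.226] -/
theorem flatWindowLetter_of_localHolder (hL2 : 2 ≤ L) {β : ℝ} (Cloc : ℝ)
    (Hloc : ∀ (n : ℕ) (η : ℝ), η * (L : ℝ) ^ (n + 1) = 1 → ∀ (c₀ : ℝ) [Fact (0 < c₀)] (m : Fin d → ℕ) [∀ i, NeZero (m i)]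
      (u : SiteL2K ℂ d (towerP L m (n + 1)) c₀ W) (f : BondL2K ℂ d (towerP L m (n + 1)) c₀ W) (x : TSite d (towerP L m (n + 1))) (Mu Mf : ℝ), 0 ≤ Mu → 0 ≤ Mf →
      covLaplaceSiteK ((η⁻¹ : ℝ) : ℂ) (fun _ : Bond d (towerP L m (n + 1)) => (LinearMap.id : W →ₗ[ℂ] W)) (fun _ => LinearMap.id) u + ((1 : ℝ) : ℂ) • u =
        covDivL2K ℂ c₀ ((η⁻¹ : ℝ) : ℂ) (fun _ : Bond d (towerP L m (n + 1)) => (LinearMap.id : W →ₗ[ℂ] W)) f →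
      (∀ y, tdist (towerP L m (n + 1)) x y ≤ 4 * (L : ℝ) ^ (n + 1) → ‖WL2.equiv ℂ (fun _ : TSite d (towerP L m (n + 1)) => c₀) W u y‖ ≤ Mu) →
      (∀ b, tdist (towerP L m (n + 1)) x (bpos b) ≤ 4 * (L : ℝ) ^ (n + 1) → ‖WL2.equiv ℂ (fun _ : Bond d (towerP L m (n + 1)) => c₀) W f b‖ ≤ Mf) →
      ∀ x', tdist (towerP L m (n + 1)) x x' ≤ (L : ℝ) ^ (n + 1) →
        ‖WL2.equiv ℂ (fun _ : TSite d (towerP L m (n + 1)) => c₀) W u x' - WL2.equiv ℂ (fun _ : TSite d (towerP L m (n + 1)) => c₀) W u x‖ ≤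
          Cloc * (Mu + Mf) * (tdist (towerP L m (n + 1)) x x' / (L : ℝ) ^ (n + 1)) ^ β) :
    ∀ (n : ℕ) (η : ℝ), η * (L : ℝ) ^ (n + 1) = 1 → ∀ (c₀ : ℝ) [Fact (0 < c₀)] (m : Fin d → ℕ) [∀ i, NeZero (m i)] (a : ℝ), 0 ≤ a →
      a * (L : ℝ) ^ (n + 1) ≤ 1 → 2 * (d : ℝ) * ((L : ℝ) ^ (n + 1)) ^ 2 * (Real.cosh a - 1) ≤ 1 / 2 →
      ∀ (x₀ : TSite d (towerP L m (n + 1))) (u : SiteL2K ℂ d (towerP L m (n + 1)) c₀ W) (f : BondL2K ℂ d (towerP L m (n + 1)) c₀ W) (F : ℝ),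
      0 ≤ F → covLaplaceSiteK ((η⁻¹ : ℝ) : ℂ) (fun _ : Bond d (towerP L m (n + 1)) => (LinearMap.id : W →ₗ[ℂ] W)) (fun _ => LinearMap.id) u + ((1 : ℝ) : ℂ) • u =
        covDivL2K ℂ c₀ ((η⁻¹ : ℝ) : ℂ) (fun _ : Bond d (towerP L m (n + 1)) => (LinearMap.id : W →ₗ[ℂ] W)) f →
      (∀ b, ‖WL2.equiv ℂ (fun _ : Bond d (towerP L m (n + 1)) => c₀) W f b‖ ≤ F * ∏ μ, Real.cosh (a * (circAbs (towerP L m (n + 1) μ) ((((x₀ μ : ℕ) : ZMod (towerP L m (n + 1) μ)) - ((bpos b μ : ℕ) : ZMod (towerP L m (n + 1) μ))).val) : ℝ))) →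
      ∀ x x', tdist (towerP L m (n + 1)) x x' ≤ (L : ℝ) ^ (n + 1) →
        ‖WL2.equiv ℂ (fun _ : TSite d (towerP L m (n + 1)) => c₀) W u x' - WL2.equiv ℂ (fun _ : TSite d (towerP L m (n + 1)) => c₀) W u x‖ ≤
          Cloc * (16 * (d : ℝ) + 1) * Real.exp (4 * (d : ℝ)) * F * (tdist (towerP L m (n + 1)) x x' / (L : ℝ) ^ (n + 1)) ^ β * ∏ μ, Real.cosh (a * (circAbs (towerP L m (n + 1) μ) ((((x₀ μ : ℕ) : ZMod (towerP L m (n + 1) μ)) - ((x μ : ℕ) : ZMod (towerP L m (n + 1) μ))).val) : ℝ)) := by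
  intro n η hηL c₀ _ m _ a ha0 haK hwin x₀ u f F hF hu hf x x' hxx
  have hK1 : (1 : ℝ) ≤ (L : ℝ) ^ (n + 1) := one_le_pow₀ (by exact_mod_cast (by omega : 1 ≤ L))
  have hK0 : (0 : ℝ) < (L : ℝ) ^ (n + 1) := lt_of_lt_of_le one_pos hK1
  have hη0 : 0 < η := by nlinarith only [hηL, hK0]
  have hηK : η⁻¹ = (L : ℝ) ^ (n + 1) := inv_eq_of_mul_eq_one_right hηL
  have hd0 : (0 : ℝ) ≤ d := Nat.cast_nonneg d
  have hm1 : ∀ i, 1 ≤ m i := fun i => Nat.one_le_iff_ne_zero.mpr (NeZero.ne (m i))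
  have hP1 : ∀ i, 1 ≤ towerP L m (n + 1) i := fun i => by
    rw [towerP_apply]; exact Nat.one_le_iff_ne_zero.2 (Nat.mul_ne_zero (pow_ne_zero _ (NeZero.ne L)) (NeZero.ne (m i)))
  have hn2 : ∀ ν : Fin d, 2 ≤ towerP L m (n + 1) ν := fun ν => by
    rw [towerP_apply]
    calc 2 ≤ L ^ 1 * 1 := by rw [pow_one, mul_one]; omega
      _ ≤ L ^ (n + 1) * m ν := Nat.mul_le_mul (Nat.pow_le_pow_right (by omega) (by omega)) (hm1 ν)
  have hPK : ∀ ν : Fin d, η⁻¹ ≤ (towerP L m (n + 1) ν : ℝ) := fun ν => by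
    rw [hηK, towerP_apply, Nat.cast_mul, Nat.cast_pow]
    exact le_mul_of_one_le_right hK0.le (by exact_mod_cast hm1 ν)
  have ha1 : a ≤ 1 := by nlinarith only [haK, hK1, ha0]
  have hat : a * η⁻¹ ≤ 1 := by rw [hηK]; exact haK
  have hlam : 1 / 2 ≤ 1 - 2 * (d : ℝ) * η⁻¹ ^ 2 * (Real.cosh a - 1) := by rw [hηK]; linarith only [hwin]
  have hlam' : 2 * (d : ℝ) * η⁻¹ ^ 2 * (Real.cosh a - 1) < 1 := by linarith only [hlam]
  -- the weighted sup row of the flat resolvent, constant `≤ 16d`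
  have hSad := sad_le_sixteen_mul (towerP L m (n + 1)) (t := η⁻¹) (a := a) (by rw [hηK]; exact hK1) ha0 ha1 hat hlam hPK
  have hW0 : ∀ y : TSite d (towerP L m (n + 1)),
      0 ≤ ∏ μ, Real.cosh (a * (circAbs (towerP L m (n + 1) μ) ((((x₀ μ : ℕ) : ZMod (towerP L m (n + 1) μ)) - ((y μ : ℕ) : ZMod (towerP L m (n + 1) μ))).val) : ℝ)) :=
    fun y => Finset.prod_nonneg fun _ _ => (Real.cosh_pos _).le
  have hrow : ∀ y, ‖WL2.equiv ℂ (fun _ : TSite d (towerP L m (n + 1)) => c₀) W u y‖ ≤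
      16 * d * F * ∏ μ, Real.cosh (a * (circAbs (towerP L m (n + 1) μ) ((((x₀ μ : ℕ) : ZMod (towerP L m (n + 1) μ)) - ((y μ : ℕ) : ZMod (towerP L m (n + 1) μ))).val) : ℝ)) :=
    fun y => (norm_apply_le_weighted_of_flat_resolvent_covDiv (P := towerP L m (n + 1)) η⁻¹ (inv_pos.2 hη0) one_pos ha0 hlam' hn2 hu x₀ hf y).trans
      (mul_le_mul_of_nonneg_right (mul_le_mul_of_nonneg_right hSad hF) (hW0 y))
  -- the weight over the ball `d(x, ·) ≤ 4L^{n+1}`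
  have he4 : Real.exp (a * d * (4 * (L : ℝ) ^ (n + 1))) ≤ Real.exp (4 * (d : ℝ)) :=
    Real.exp_le_exp.2 (by nlinarith only [mul_le_mul_of_nonneg_left haK hd0, ha0, hd0])
  have hWx : ∀ p : TSite d (towerP L m (n + 1)), tdist (towerP L m (n + 1)) x p ≤ 4 * (L : ℝ) ^ (n + 1) →
      ∏ μ, Real.cosh (a * (circAbs (towerP L m (n + 1) μ) ((((x₀ μ : ℕ) : ZMod (towerP L m (n + 1) μ)) - ((p μ : ℕ) : ZMod (towerP L m (n + 1) μ))).val) : ℝ)) ≤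
        Real.exp (4 * (d : ℝ)) * ∏ μ, Real.cosh (a * (circAbs (towerP L m (n + 1) μ) ((((x₀ μ : ℕ) : ZMod (towerP L m (n + 1) μ)) - ((x μ : ℕ) : ZMod (towerP L m (n + 1) μ))).val) : ℝ)) :=
    fun p hp => (weight_le_exp_mul_of_tdist_le (P := towerP L m (n + 1)) ha0 x₀ x p (by rw [tdist_symm hP1]; exact hp)).trans
      (mul_le_mul_of_nonneg_right he4 (hW0 x))
  -- the local sup letters
  have hMu : ∀ y, tdist (towerP L m (n + 1)) x y ≤ 4 * (L : ℝ) ^ (n + 1) → ‖WL2.equiv ℂ (fun _ : TSite d (towerP L m (n + 1)) => c₀) W u y‖ ≤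
      16 * d * F * (Real.exp (4 * (d : ℝ)) * ∏ μ, Real.cosh (a * (circAbs (towerP L m (n + 1) μ) ((((x₀ μ : ℕ) : ZMod (towerP L m (n + 1) μ)) - ((x μ : ℕ) : ZMod (towerP L m (n + 1) μ))).val) : ℝ))) :=
    fun y hy => (hrow y).trans (mul_le_mul_of_nonneg_left (hWx y hy) (by positivity))
  have hMf : ∀ b : Bond d (towerP L m (n + 1)), tdist (towerP L m (n + 1)) x (bpos b) ≤ 4 * (L : ℝ) ^ (n + 1) →
      ‖WL2.equiv ℂ (fun _ : Bond d (towerP L m (n + 1)) => c₀) W f b‖ ≤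
        F * (Real.exp (4 * (d : ℝ)) * ∏ μ, Real.cosh (a * (circAbs (towerP L m (n + 1) μ) ((((x₀ μ : ℕ) : ZMod (towerP L m (n + 1) μ)) - ((x μ : ℕ) : ZMod (towerP L m (n + 1) μ))).val) : ℝ))) :=
    fun b hb => (hf b).trans (mul_le_mul_of_nonneg_left (hWx (bpos b) hb) hF)
  have h := Hloc n η hηL c₀ m u f x _ _ (by positivity) (by positivity) hu hMu hMf x' hxx
  refine h.trans (le_of_eq ?_)
  ring

end Reduction

/-! ## §2 The (117) socket for the full `𝔊̃_k` on the model from `Hloc` and (HLb) -/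

section Socket

open B4Sect5Torus (TSite tdist tdist_nonneg)
open B9SectCLatticeCarrier (Bond bpos btgt unshift)
open B9Eq311L2Pairing (WL2)
open B9Eq319QprimeTorus (fineP blockCoord)
open B7Prop1Explicit (U1 Wcx boxVec)
open B11Eq103H1Complex (SiteL2K BondL2K greenK covDerivL2K covDivL2K covLaplaceSiteK G1LatticeK frakGLatticeK)
open B9Eq310DeltaPrime (plaqHolU)
open B9Eq310HessianOperator (adTransportW)
open B9Eq315QTorus (perCfg cornerSite)
open B9Eq315QTower (towerP UlevOf)
open B9Eq316TowerFlatIsOneStep (towerP_eq_fineP_pow siteCast)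
open B9Eq326OperatorTower (QprimeTowerW RofUk laplaceAk QkW)
open B9Eq3119DeltaPiTower (laplaceAkPi)
open B9Eq324DeltaPrimeATower (laplacePrimeAk GpOfUk)
open B9Eq325ProjFormulaTower (QGGQk_pos_of_unitary)
open B9Eq33CovDerivVector (covGrad)
open B11Eq115Space (NegSup levWeight)
open B11Eq111FrakG (toCLM115)
open B9Eq3152StoreyHTwoHolderMembers (exists_norm_toCLM115_frakGkPi_le_of_twoHolderMembers)
open B9Eq342GreenPrimeDstarValueRowTower (exists_valueRow_GpOfUk_covDiv)
open B4TorusKernel.MultiPeriod (circAbs)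
open B9Eq3152StoreyHOfFlatWindowLetter (exists_norm_toCLM115_frakGkPi_le_of_flatWindow_hessian)

variable {d : ℕ} (hd : 1 ≤ d) (L : ℕ) [NeZero L] (hL : 1 ≤ L) (hL3 : 3 ≤ L)
  {𝔸 : Type*} [NormedRing 𝔸] [NormedAlgebra ℂ 𝔸] [CompleteSpace 𝔸] [NormOneClass 𝔸] [StarRing 𝔸] [NormedStarGroup 𝔸] [StarModule ℂ 𝔸]
  {W : Type*} [NormedAddCommGroup W] [InnerProductSpace ℂ W] [FiniteDimensional ℂ W] (φ : W ≃ₗ[ℂ] 𝔸)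
  {Mφ Mφ' : ℝ} (hMφ : 0 ≤ Mφ) (hMφ' : 0 ≤ Mφ') (hφ : ∀ w, ‖φ w‖ ≤ Mφ * ‖w‖) (hφ' : ∀ X, ‖φ.symm X‖ ≤ Mφ' * ‖X‖) (hstar : ∀ X : 𝔸, ‖star X‖ ≤ ‖X‖)
  {a : ℝ} (ha : 0 < a) {a' : ℝ} (ha' : 0 < a') {ϱ : ℝ} (hϱ0 : 0 ≤ ϱ) (hϱ1 : ϱ < 1)
  (τ : 𝔸 →ₗ[ℂ] ℂ) {Cτ : ℝ} (hτ : ∀ X, ‖τ X‖ ≤ Cτ * ‖X‖) (hCτ : 0 ≤ Cτ) {Mτ : ℝ} (hτm : ∀ X Y : 𝔸, ‖τ (X * Y)‖ ≤ Mτ * ‖X‖ * ‖Y‖) (hMτ : 0 ≤ Mτ)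
  {ρw : ℝ} (hρw : 0 ≤ ρw)
  (hτ₁ : ∀ X : 𝔸, τ (star X) = conj (τ X)) (hτ₂ : ∀ X Y : 𝔸, τ (X * Y) = τ (Y * X)) (hφτ : ∀ X Y : 𝔸, ⟪φ.symm X, φ.symm Y⟫_ℂ = τ (star X * Y))
  (AQ : ℝ)

set_option maxHeartbeats 800000 in -- three ≈ 50-binder blocks
include hd hL hL3 hMφ hMφ' hφ hφ' hstar ha ha' hϱ0 hϱ1 hτ hCτ hτm hMτ hρw hτ₁ hτ₂ hφτ in
/-- **THE HEADLINE OF STOREY H WITH (HLaH) REDUCED TO THE LOCAL FLAT HÖLDER ESTIMATE: the (117) socket `‖toCLM115 ∇_U 𝔊̃_k‖ ≤ max(w̄₀B, w̄₁B)·w̲⁻¹` for the FULL `𝔊̃_k` ON THE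
MODEL from `Hloc` (interior η-scale `C^β` regularity of the flat massive lattice equation with divergence-form bounded data) and (HLb) = Thm 3.1 (3.44) for `G′_k`** —
`B9Eq3152StoreyHOfFlatWindowLetter.exists_norm_toCLM115_frakGkPi_le_of_flatWindow_hessian` with `HflatW := flatWindowLetter_of_localHolder Hloc`.
[cite: Balaban1985Variational, (117) p.295; Balaban1985BackgroundPropagators, Thm 3.13 p.426, Thm 3.1 (3.42)–(3.44) pp.397–398, (3.152)–(3.153) p.426, (3.25) p.394] -/
theorem exists_norm_toCLM115_frakGkPi_le_of_localHolder_hessian {β : ℝ} (hβ0 : 0 < β) (hβ1 : β ≤ 1) (Cloc : ℝ) (hCloc : 0 ≤ Cloc)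
    (Hloc : ∀ (n : ℕ) (η : ℝ), η * (L : ℝ) ^ (n + 1) = 1 → ∀ (c₀ : ℝ) [Fact (0 < c₀)] (m : Fin d → ℕ) [∀ i, NeZero (m i)]
      (u : SiteL2K ℂ d (towerP L m (n + 1)) c₀ W) (f : BondL2K ℂ d (towerP L m (n + 1)) c₀ W) (x : TSite d (towerP L m (n + 1))) (Mu Mf : ℝ), 0 ≤ Mu → 0 ≤ Mf →
      covLaplaceSiteK ((η⁻¹ : ℝ) : ℂ) (fun _ : Bond d (towerP L m (n + 1)) => (LinearMap.id : W →ₗ[ℂ] W)) (fun _ => LinearMap.id) u + ((1 : ℝ) : ℂ) • u =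
        covDivL2K ℂ c₀ ((η⁻¹ : ℝ) : ℂ) (fun _ : Bond d (towerP L m (n + 1)) => (LinearMap.id : W →ₗ[ℂ] W)) f →
      (∀ y, tdist (towerP L m (n + 1)) x y ≤ 4 * (L : ℝ) ^ (n + 1) → ‖WL2.equiv ℂ (fun _ : TSite d (towerP L m (n + 1)) => c₀) W u y‖ ≤ Mu) →
      (∀ b, tdist (towerP L m (n + 1)) x (bpos b) ≤ 4 * (L : ℝ) ^ (n + 1) → ‖WL2.equiv ℂ (fun _ : Bond d (towerP L m (n + 1)) => c₀) W f b‖ ≤ Mf) →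
      ∀ x', tdist (towerP L m (n + 1)) x x' ≤ (L : ℝ) ^ (n + 1) →
        ‖WL2.equiv ℂ (fun _ : TSite d (towerP L m (n + 1)) => c₀) W u x' - WL2.equiv ℂ (fun _ : TSite d (towerP L m (n + 1)) => c₀) W u x‖ ≤
          Cloc * (Mu + Mf) * (tdist (towerP L m (n + 1)) x x' / (L : ℝ) ^ (n + 1)) ^ β)
    (HLb : ∀ ε : ℝ, 0 < ε → ε ≤ 1 → ∃ αb Bb δb : ℝ, 0 < αb ∧ 0 ≤ Bb ∧ 0 < δb ∧
      ∀ (n : ℕ) (η : ℝ) (_hηL : η * (L : ℝ) ^ (n + 1) = 1) (c₀ c₁ : ℝ) [Fact (0 < c₀)] [Fact (0 < c₁)]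
        (_hw : c₀ * ((L : ℝ) ^ (n + 1)) ^ d = c₁) (_hρ : |η| ^ d / c₀ ≤ ρw) (m : Fin d → ℕ) [∀ i, NeZero (m i)] (_hm : ∀ i, 1 ≤ m i)
        (U : Bond d (towerP L m (n + 1)) → 𝔸ˣ) (αU : ℕ → ℝ) (_hα0 : ∀ j, 0 ≤ αU j) (hα1 : ∀ j, αU j ≤ 1 / 64)
        (hU1 : ∀ (j : ℕ) (x : B7Prop1Explicit.Site d) (k : Fin d), perCfg (towerP L m (j + 1)) (UlevOf L m (n + 1) U j) x k ∈ U1 𝔸)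
        (hreg : ∀ (j : ℕ) (y : TSite d (towerP L m j)) (k : Fin d) (ρ' : Fin d → Fin L),
          ‖((Wcx L (perCfg (towerP L m (j + 1)) (UlevOf L m (n + 1) U j)) (cornerSite L y) k (boxVec L ρ') : 𝔸ˣ) : 𝔸) - 1‖ ≤ αU j)
        (εU : ℕ → ℝ) (_hεU : ∀ j, 0 ≤ εU j) (_hUε : ∀ (j : ℕ) (b : Bond d (towerP L m (j + 1))), ‖(UlevOf L m (n + 1) U j b : 𝔸) - 1‖ ≤ εU j)
        (_hLb : ∀ (j : ℕ) (b : Bond d (towerP L m (j + 1))), UlevOf L m (n + 1) U j b ∈ U1 𝔸)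
        (α : ℝ) (_hα : 0 ≤ α) (_hαle : α ≤ αb)
        (hUst : ∀ b, star (U b : 𝔸) = (((U b)⁻¹ : 𝔸ˣ) : 𝔸)) (_hUb : ∀ b, U b ∈ U1 𝔸) (_hUη : ∀ b, ‖(U b : 𝔸) - 1‖ ≤ α * η)
        (_hpl : ∀ p : B9SectCLatticeCarrier.Plaq d (towerP L m (n + 1)), ‖(plaqHolU U p : 𝔸) - 1‖ ≤ α * η ^ 2)
        (_hUgrad : ∀ (x : TSite d (towerP L m (n + 1))) (μ : Fin d), ‖(U (x, μ) : 𝔸) - U (unshift μ x, μ)‖ ≤ α * η ^ 2)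
        (_hRlev : ∀ (j : ℕ) (b : Bond d (towerP L m (j + 1))) (w : W), ‖adTransportW φ (UlevOf L m (n + 1) U j) b w‖ ≤ ‖w‖)
        (_hεg : ∀ j < n + 1, εU j ≤ α * ϱ ^ j) (_hAQ : ∑ j ∈ Finset.range (n + 1), αU j ≤ AQ)
        (hpos' : ∀ x : SiteL2K ℂ d (towerP L m (n + 1)) c₀ W, x ≠ 0 → 0 < RCLike.re ⟪x, laplacePrimeAk L m n φ η U a' (c₁ := c₁) x⟫_ℂ)
        (hpos : ∀ x : BondL2K ℂ d (towerP L m (n + 1)) c₀ W, x ≠ 0 →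
          0 < RCLike.re ⟪x, laplaceAk L m n φ η U hL αU hα1 hU1 hreg τ (c₀ := c₀) (c₁ := c₁) a x⟫_ℂ)
        (hposπ : ∀ x : BondL2K ℂ d (towerP L m (n + 1)) c₀ W, x ≠ 0 →
          0 < RCLike.re ⟪x, laplaceAkPi L m n φ τ η U a' hpos' hL αU hα1 hU1 hreg (c₁ := c₁) a x⟫_ℂ)
        (_hc₀ : c₀ = η ^ d)
        (_hJ : ∀ (μ : Fin d) (y : TSite d (towerP L m (n + 1))),
          ‖B9Eq39Adjoint.J (fun μ => B9Eq33CovDerivVector.shiftEquiv μ) (fun μ y => U (y, μ)) η μ y‖ ≤ α)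
        (y' : TSite d m) (lam : SiteL2K ℂ d (towerP L m (n + 1)) c₀ W) (N H : ℝ) (_hN : 0 ≤ N) (_hH : 0 ≤ H)
        (_hsupp : ∀ x, WL2.equiv ℂ (fun _ : TSite d (towerP L m (n + 1)) => c₀) W lam x ≠ 0 → tdist m (blockCoord (L ^ (n + 1)) m (siteCast (towerP_eq_fineP_pow L m (n + 1)) x)) y' ≤ 1)
        (_hval : ∀ x, ‖WL2.equiv ℂ (fun _ : TSite d (towerP L m (n + 1)) => c₀) W lam x‖ ≤ N)
        (_hhol : ∀ x x' : TSite d (towerP L m (n + 1)), tdist (towerP L m (n + 1)) x x' ≤ ((L ^ (n + 1) : ℕ) : ℝ) →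
          ‖WL2.equiv ℂ (fun _ : TSite d (towerP L m (n + 1)) => c₀) W lam x' - WL2.equiv ℂ (fun _ : TSite d (towerP L m (n + 1)) => c₀) W lam x‖ ≤ H * (tdist (towerP L m (n + 1)) x x' / ((L ^ (n + 1) : ℕ) : ℝ)) ^ ε)
        (μ : Fin d) (b : Bond d (towerP L m (n + 1))),
        ‖WL2.equiv ℂ (fun _ : Bond d (towerP L m (n + 1)) => c₀) W (covDerivL2K ℂ c₀ ((η : ℂ))⁻¹ (adTransportW φ U)
            ((WL2.equiv ℂ (fun _ : TSite d (towerP L m (n + 1)) => c₀) W).symm fun y => WL2.equiv ℂ (fun _ : Bond d (towerP L m (n + 1)) => c₀) W (covDerivL2K ℂ c₀ ((η : ℂ))⁻¹ (adTransportW φ U) (GpOfUk L m n φ η U a' (c₁ := c₁) hpos' lam)) (y, μ))) b‖ ≤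
          Bb * Real.exp (-(δb * tdist m (blockCoord (L ^ (n + 1)) m (siteCast (towerP_eq_fineP_pow L m (n + 1)) (bpos b))) y')) * (N + H)) :
    ∃ α₁ j₁ B : ℝ, 0 < α₁ ∧ 0 < j₁ ∧ 0 ≤ B ∧
      ∀ (n : ℕ) (η : ℝ) (_hηL : η * (L : ℝ) ^ (n + 1) = 1) (c₀ c₁ : ℝ) [Fact (0 < c₀)] [Fact (0 < c₁)]
        (_hw : c₀ * ((L : ℝ) ^ (n + 1)) ^ d = c₁) (_hρ : |η| ^ d / c₀ ≤ ρw) (m : Fin d → ℕ) [∀ i, NeZero (m i)] (_hm : ∀ i, 1 ≤ m i)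
        (U : Bond d (towerP L m (n + 1)) → 𝔸ˣ) (αU : ℕ → ℝ) (_hα0 : ∀ j, 0 ≤ αU j) (hα1 : ∀ j, αU j ≤ 1 / 64)
        (hαL : ∀ j, 50 * (d + 1) * αU j * (L : ℝ) ^ d ≤ 1 / 2)
        (hU1 : ∀ (j : ℕ) (x : B7Prop1Explicit.Site d) (k : Fin d), perCfg (towerP L m (j + 1)) (UlevOf L m (n + 1) U j) x k ∈ U1 𝔸)
        (hreg : ∀ (j : ℕ) (y : TSite d (towerP L m j)) (k : Fin d) (ρ' : Fin d → Fin L),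
          ‖((Wcx L (perCfg (towerP L m (j + 1)) (UlevOf L m (n + 1) U j)) (cornerSite L y) k (boxVec L ρ') : 𝔸ˣ) : 𝔸) - 1‖ ≤ αU j)
        (εU : ℕ → ℝ) (_hεU : ∀ j, 0 ≤ εU j) (_hUε : ∀ (j : ℕ) (b : Bond d (towerP L m (j + 1))), ‖(UlevOf L m (n + 1) U j b : 𝔸) - 1‖ ≤ εU j)
        (_hLb : ∀ (j : ℕ) (b : Bond d (towerP L m (j + 1))), UlevOf L m (n + 1) U j b ∈ U1 𝔸)
        (α : ℝ) (_hα : 0 ≤ α) (_hαle : α ≤ α₁)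
        (hUst : ∀ b, star (U b : 𝔸) = (((U b)⁻¹ : 𝔸ˣ) : 𝔸)) (_hUb : ∀ b, U b ∈ U1 𝔸) (_hUη : ∀ b, ‖(U b : 𝔸) - 1‖ ≤ α * η)
        (_hpl : ∀ p : B9SectCLatticeCarrier.Plaq d (towerP L m (n + 1)), ‖(plaqHolU U p : 𝔸) - 1‖ ≤ α * η ^ 2)
        (_hUgrad : ∀ (x : TSite d (towerP L m (n + 1))) (μ : Fin d), ‖(U (x, μ) : 𝔸) - U (unshift μ x, μ)‖ ≤ α * η ^ 2)
        (_hRlev : ∀ (j : ℕ) (b : Bond d (towerP L m (j + 1))) (w : W), ‖adTransportW φ (UlevOf L m (n + 1) U j) b w‖ ≤ ‖w‖)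
        (_hεg : ∀ j < n + 1, εU j ≤ α * ϱ ^ j) (_hAQ : ∑ j ∈ Finset.range (n + 1), αU j ≤ AQ)
        (hpos' : ∀ x : SiteL2K ℂ d (towerP L m (n + 1)) c₀ W, x ≠ 0 → 0 < RCLike.re ⟪x, laplacePrimeAk L m n φ η U a' (c₁ := c₁) x⟫_ℂ)
        (hpos : ∀ x : BondL2K ℂ d (towerP L m (n + 1)) c₀ W, x ≠ 0 →
          0 < RCLike.re ⟪x, laplaceAk L m n φ η U hL αU hα1 hU1 hreg τ (c₀ := c₀) (c₁ := c₁) a x⟫_ℂ)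
        (_hc₀η : c₀ = η ^ d) (j₀ : ℝ) (_hJ : ∀ μ y, ‖B9Eq39Adjoint.J (fun μ => B9Eq33CovDerivVector.shiftEquiv μ) (fun μ y => U (y, μ)) η μ y‖ ≤ j₀) (_hj : j₀ ≤ j₁)
        (hposπ : ∀ x : BondL2K ℂ d (towerP L m (n + 1)) c₀ W, x ≠ 0 →
          0 < RCLike.re ⟪x, laplaceAkPi L m n φ τ η U a' hpos' hL αU hα1 hU1 hreg (c₁ := c₁) a x⟫_ℂ)
        (hQ : Function.Surjective (QkW L m n φ U hL αU hα1 hU1 hreg (c₀ := c₀) (c₁ := c₁)))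
        (Lw ηw : ℝ) [Fact (0 < Lw)] [Fact (0 < ηw)] (lev₀ : Bond d (towerP L m (n + 1)) → ℕ) (lev₁ : Bond d (towerP L m (n + 1)) × Fin d → ℕ),
        ‖toCLM115 (L := Lw) (η := ηw) (lev₀ := lev₀) lev₁ (covGrad ((η : ℂ))⁻¹ (adTransportW φ U))
            ((WL2.linearEquiv ℂ ℂ (fun _ : Bond d (towerP L m (n + 1)) => c₀)).toLinearMap ∘ₗ (frakGLatticeK hposπ hQ : _ →ₗ[ℂ] _) ∘ₗ
              ((WL2.linearEquiv ℂ ℂ (fun _ : Bond d (towerP L m (n + 1)) => c₀)).symm.toLinearMap :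
                (Bond d (towerP L m (n + 1)) → W) →ₗ[ℂ] BondL2K ℂ d (towerP L m (n + 1)) c₀ W))‖ ≤
          max ((NegSup.wSup (levWeight Lw ηw lev₀ 1) : ℝ) * B) (NegSup.wSup (levWeight Lw ηw lev₁ 2) * B) *
            NegSup.wInvSup (levWeight Lw ηw lev₀ 3) :=
  exists_norm_toCLM115_frakGkPi_le_of_flatWindow_hessian hd L hL hL3 φ hMφ hMφ' hφ hφ' hstar ha ha' hϱ0 hϱ1 τ hτ hCτ hτm hMτ hρw hτ₁ hτ₂ hφτ AQ hβ0 hβ1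
    (Cloc * (16 * (d : ℝ) + 1) * Real.exp (4 * (d : ℝ))) (by positivity) (flatWindowLetter_of_localHolder L (by omega) Cloc Hloc) HLb

end Socket

end Literature.MathematicalPhysics.QuantumFieldTheory.Balaban1983to89.B9Eq343FlatWindowLetterOfLocalHolder

end
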